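import Summits.ABC.ABC.Theses.DefiniteXi
import Literature.NumberTheory.Automorphic.BrandtSetupAdmissible
import Literature.NumberTheory.EllipticCurves.SzpiroFreyConductorProofs
import Literature.NumberTheory.Automorphic.BrandtXiSetupIndependence
import Literature.NumberTheory.EllipticCurves.DegreeConjectureAbcMurtyProofs

/-!
# `XiBound` (stmt-ABC-11336, route ABC/DefiniteXi) — negative-side lemmas I: the domain is setup-backed

Standing-adversary (cdisprove) output for the crux `Summit.ABC.ABC.Theses.DefiniteXi.XiBound`
(`∃ A C, ξ(E_(a,b); N/N⁻, N⁻) ≤ C·N^A` for all coprime `a, b` and admissible `N⁻ ∣ N`).  Proved here: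

* `not_sq_dvd_conductorNorm_freyCurve`, `nonempty_xiSetup_freyCurve` — at odd primes `q² ∤ N(E_(a,b))`
  (`N ∣ 2⁸ rad`), so for odd squarefree `N⁻ ∣ N` with `ω(N⁻)` odd a Brandt setup of type `(N/N⁻, N⁻)`
  EXISTS (`Brandt.nonempty_xiSetup_iff_admissible`): on the crux's whole domain `brandtXi` is the genuine
  congruence number (`Brandt.XiSetup.brandtXi_eq_xi`), never the junk `0` of a missing setup;
* `xiBound_iff_forall_setup` — `XiBound` ⟺ the same bound on `S.xi` for EVERY setup `S`;
* `xiBound_iff_dropParityAndSquarefree` — the guards `Squarefree N⁻`, `Odd ω(N⁻)` are decorative for the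
  upper bound (dropping them only adds setup-less instances, value `0`);
* `nonempty_xiSetup_freyCurve_even_iff` — for EVEN squarefree `N⁻` (guard `Odd N⁻` dropped) a setup
  exists iff `2 ∤ N/N⁻`;
* `xiBound_no_admissible_dvd_two_pow`, `xiBound_hyps_witness` — `N = 2^k` carries no admissible `N⁻`;
  `(a, b) = (1, 2)`, `N⁻ = 3` satisfies all hypotheses;
* `not_xiBound_twoSided_dropParity` — the natural two-sided strengthening `1 ≤ ξ ≤ C N^A` over all odd
  squarefree `N⁻ ∣ N` is FALSE (`(a,b) = (3,5)`, `N⁻ = 15`: `ω` even, no setup, `ξ = 0`): the parity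
  guard is load-bearing for every LOWER-bound use of `ξ`.

Refuter seat cdisprove-stmt-ABC-11336-g2, 2026-08-15; companion files `XiBoundLocks`,
`XiBoundTakahashiSqueeze` in this directory.
-/

namespace Summit.ABC.ABC.Theorems.XiBound.Negative

open Literature.NumberTheory.Automorphic Literature.NumberTheory.EllipticCurves

/-- At an odd prime `q` the conductor of the Frey curve `E_(a,b)` (`a, b` coprime, `ab(a+b) ≠ 0`) is not
divisible by `q²`: `N ∣ 2⁸ · rad(ab(a+b))` (`conductorNorm_freyCurve_dvd_holds`) and the radical is
squarefree. [folklore] -/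
theorem not_sq_dvd_conductorNorm_freyCurve {a b : ℤ} (hab : IsCoprime a b) (h0 : a * b * (a + b) ≠ 0)
    {q : ℕ} (hq : q.Prime) (hq2 : q ≠ 2) : ¬ q * q ∣ (freyCurve a b).conductorNorm ℤ := by
  intro hsqN
  have hqq : q * q ∣ 2 ^ 8 * (UniqueFactorizationMonoid.radical (a * b * (a + b))).natAbs :=
    hsqN.trans (conductorNorm_freyCurve_dvd_holds a b hab h0)
  have hcop : Nat.Coprime (q * q) (2 ^ 8) :=
    Nat.Coprime.pow_right 8 (Nat.Coprime.mul_left ((Nat.coprime_primes hq Nat.prime_two).mpr hq2)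
      ((Nat.coprime_primes hq Nat.prime_two).mpr hq2))
  have hsqR : Squarefree (UniqueFactorizationMonoid.radical (a * b * (a + b))).natAbs :=
    Int.squarefree_natAbs.mpr UniqueFactorizationMonoid.squarefree_radical
  exact hq.one_lt.ne' (Nat.isUnit_iff.mp (hsqR q (hcop.dvd_of_dvd_mul_left hqq)))

/-- **On the domain of `XiBound` a Brandt setup of type `(N/N⁻, N⁻)` exists**: for coprime `a, b` with
`ab(a+b) ≠ 0`, `N = N(E_(a,b))`, and `N⁻` odd, squarefree, with an odd number of prime factors and
`N⁻ ∣ N`, the type `Brandt.XiSetup (N/N⁻) N⁻` is inhabited (`N/N⁻ ≥ 1`, `gcd(N/N⁻, N⁻) = 1` by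
`not_sq_dvd_conductorNorm_freyCurve`, and the tree's `Brandt.nonempty_xiSetup_iff_admissible`). Hence
`brandtXi (N/N⁻) N⁻ (a(E_(a,b)))` in the crux is the genuine congruence number of a setup
(`Brandt.XiSetup.brandtXi_eq_xi`), never the junk value `0` of a missing setup. [folklore] -/
theorem nonempty_xiSetup_freyCurve {a b : ℤ} (hab : IsCoprime a b) (h0 : a * b * (a + b) ≠ 0)
    {Nm : ℕ} (hodd : Odd Nm) (hsq : Squarefree Nm) (hcard : Odd Nm.primeFactors.card)
    (hdvd : Nm ∣ (freyCurve a b).conductorNorm ℤ) :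
    Nonempty (Brandt.XiSetup ((freyCurve a b).conductorNorm ℤ / Nm) Nm) := by
  haveI := isElliptic_freyCurve h0
  have hN : 0 < (freyCurve a b).conductorNorm ℤ := WeierstrassCurve.conductorNorm_pos_holds _
  have hNm : 0 < Nm := Nat.pos_of_ne_zero fun h => by subst h; exact absurd hsq (by simp)
  refine Brandt.nonempty_xiSetup_iff_admissible.mpr
    ⟨Nat.div_pos (Nat.le_of_dvd hN hdvd) hNm, hsq, hcard, Nat.coprime_of_dvd fun q hq hqK hqNm => ?_⟩
  have hq2 : q ≠ 2 := by
    rintro rfl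
    exact (Nat.not_even_iff_odd.mpr hodd) (even_iff_two_dvd.mpr hqNm)
  refine not_sq_dvd_conductorNorm_freyCurve hab h0 hq hq2 ?_
  have : q * q ∣ ((freyCurve a b).conductorNorm ℤ / Nm) * Nm := mul_dvd_mul hqK hqNm
  rwa [Nat.div_mul_cancel hdvd] at this

/-- `brandtXi` at the crux's arguments is the `ξ` of EVERY Brandt setup (the tree's unconditional
setup-independence `Brandt.XiSetup.brandtXi_eq_xi`, Pollack–Weston 2011 §2.1). [folklore] -/
theorem brandtXi_freyCurve_eq_xi {Nplus Nm : ℕ} (S : Brandt.XiSetup Nplus Nm) (a b : ℤ) :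
    brandtXi Nplus Nm (fun n => (freyCurve a b).LFunction n) =
      S.xi (fun n => (freyCurve a b).LFunction n) :=
  S.brandtXi_eq_xi _

/-- **`XiBound` in setup form**: the crux is equivalent to the same bound on `S.xi` for EVERY Brandt setup
`S` of type `(N/N⁻, N⁻)` (a setup exists on the whole domain, `nonempty_xiSetup_freyCurve`, and all
setups compute `brandtXi`).  Provers may fix a favourite realisation of the Brandt module; refuters may
use any. [folklore] -/
theorem xiBound_iff_forall_setup :
    Summit.ABC.ABC.Theses.DefiniteXi.XiBound ↔
      ∃ A C : ℝ, ∀ a b : ℤ, IsCoprime a b → a * b * (a + b) ≠ 0 → ∀ (N : ℕ) [NeZero N],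
        (freyCurve a b).conductorNorm ℤ = N → ∀ Nm : ℕ, Odd Nm → Squarefree Nm →
        Odd Nm.primeFactors.card → Nm ∣ N → ∀ S : Brandt.XiSetup (N / Nm) Nm,
        (S.xi (fun n => (freyCurve a b).LFunction n) : ℝ) ≤ C * (N : ℝ) ^ A := by
  constructor
  · rintro ⟨A, C, h⟩
    refine ⟨A, C, fun a b hab h0 N _ hN Nm h1 h2 h3 h4 S => ?_⟩
    rw [← brandtXi_freyCurve_eq_xi S a b]
    exact h a b hab h0 N hN Nm h1 h2 h3 h4
  · rintro ⟨A, C, h⟩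
    refine ⟨A, C, fun a b hab h0 N _ hN Nm h1 h2 h3 h4 => ?_⟩
    subst hN
    obtain ⟨S⟩ := nonempty_xiSetup_freyCurve hab h0 h1 h2 h3 h4
    rw [brandtXi_freyCurve_eq_xi S a b]
    exact h a b hab h0 _ rfl Nm h1 h2 h3 h4 S

/-- **The guards `Squarefree N⁻` and `Odd ω(N⁻)` are decorative** for the upper bound: `XiBound` is
equivalent to the version keeping only `Odd N⁻` and `N⁻ ∣ N`.  Dropping them adds only instances with no
Brandt setup (`Brandt.XiSetup.squarefree`, `Brandt.XiSetup.odd_card_primeFactors`), where `brandtXi` is the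
junk value `0 ≤ C N^A` (after normalising `C ≥ 0`).  The guards are there for the honesty of the object,
not for the truth of the bound. [folklore] -/
theorem xiBound_iff_dropParityAndSquarefree :
    Summit.ABC.ABC.Theses.DefiniteXi.XiBound ↔
      ∃ A C : ℝ, ∀ a b : ℤ, IsCoprime a b → a * b * (a + b) ≠ 0 → ∀ (N : ℕ) [NeZero N],
        (freyCurve a b).conductorNorm ℤ = N → ∀ Nm : ℕ, Odd Nm → Nm ∣ N →
        (brandtXi (N / Nm) Nm (fun n => (freyCurve a b).LFunction n) : ℝ) ≤ C * (N : ℝ) ^ A := by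
  constructor
  · rintro ⟨A, C, h⟩
    refine ⟨A, max C 0, fun a b hab h0 N _ hN Nm h1 h4 => ?_⟩
    have hNA : (0 : ℝ) ≤ (N : ℝ) ^ A := Real.rpow_nonneg (Nat.cast_nonneg _) _
    have hnn : (0 : ℝ) ≤ max C 0 * (N : ℝ) ^ A := mul_nonneg (le_max_right _ _) hNA
    by_cases h2 : Squarefree Nm
    · by_cases h3 : Odd Nm.primeFactors.card
      · exact (h a b hab h0 N hN Nm h1 h2 h3 h4).trans (mul_le_mul_of_nonneg_right (le_max_left _ _) hNA)
      · rw [brandtXi_of_isEmpty ⟨fun S => h3 S.odd_card_primeFactors⟩, Nat.cast_zero]; exact hnn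
    · rw [brandtXi_of_isEmpty ⟨fun S => h2 S.squarefree⟩, Nat.cast_zero]; exact hnn
  · rintro ⟨A, C, h⟩
    exact ⟨A, C, fun a b hab h0 N _ hN Nm h1 _ _ h4 => h a b hab h0 N hN Nm h1 h4⟩

/-- **Guard `Odd N⁻` dropped**: for EVEN squarefree `N⁻ ∣ N` with `ω(N⁻)` odd (e.g. `N⁻ = 30`) a setup
of type `(N/N⁻, N⁻)` exists iff `2 ∤ N/N⁻`, i.e. iff `2 ∥ N` (Frey curve semistable at `2`); otherwise
`brandtXi = 0`.  So the version of the crux without `Odd N⁻` is a STRONGER statement whose extra genuine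
instances (forms Steinberg at `2`) have the same polynomial-Szpiro strength — possibly unnecessary, not
refutable. [folklore] -/
theorem nonempty_xiSetup_freyCurve_even_iff {a b : ℤ} (hab : IsCoprime a b) (h0 : a * b * (a + b) ≠ 0)
    {Nm : ℕ} (heven : Even Nm) (hsq : Squarefree Nm) (hcard : Odd Nm.primeFactors.card)
    (hdvd : Nm ∣ (freyCurve a b).conductorNorm ℤ) :
    Nonempty (Brandt.XiSetup ((freyCurve a b).conductorNorm ℤ / Nm) Nm) ↔
      ¬ 2 ∣ (freyCurve a b).conductorNorm ℤ / Nm := by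
  haveI := isElliptic_freyCurve h0
  have hN : 0 < (freyCurve a b).conductorNorm ℤ := WeierstrassCurve.conductorNorm_pos_holds _
  have hNm : 0 < Nm := Nat.pos_of_ne_zero fun h => by subst h; exact absurd hsq (by simp)
  have h2Nm : 2 ∣ Nm := even_iff_two_dvd.mp heven
  rw [Brandt.nonempty_xiSetup_iff_admissible]
  constructor
  · rintro ⟨-, -, -, hcop⟩ h2
    exact Nat.not_coprime_of_dvd_of_dvd one_lt_two h2 h2Nm hcop
  · intro h2
    refine ⟨Nat.div_pos (Nat.le_of_dvd hN hdvd) hNm, hsq, hcard,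
      Nat.coprime_of_dvd fun q hq hqK hqNm => ?_⟩
    rcases eq_or_ne q 2 with rfl | hq2
    · exact h2 hqK
    · refine not_sq_dvd_conductorNorm_freyCurve hab h0 hq hq2 ?_
      have : q * q ∣ ((freyCurve a b).conductorNorm ℤ / Nm) * Nm := mul_dvd_mul hqK hqNm
      rwa [Nat.div_mul_cancel hdvd] at this

/-- **`N = 2^k` carries no admissible `N⁻`** (an odd `Nm ∣ 2^k` is `1`, and `ω(1) = 0` is even): the six
coprime pairs with `|a|, |b|, |a+b|` powers of two impose nothing on `(A, C)`; no degenerate instance of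
the crux lives there. [folklore] -/
theorem xiBound_no_admissible_dvd_two_pow {k Nm : ℕ} (hodd : Odd Nm) (hcard : Odd Nm.primeFactors.card)
    (hdvd : Nm ∣ 2 ^ k) : False := by
  obtain ⟨j, -, rfl⟩ := (Nat.dvd_prime_pow Nat.prime_two).mp hdvd
  rcases j with _ | j
  · simp at hcard
  · exact (Nat.not_even_iff_odd.mpr hodd) ⟨2 ^ j, by ring⟩

/-- **Non-vacuity witness**: `(a, b) = (1, 2)` is coprime with `ab(a+b) = 6 ≠ 0`, and `N⁻ = 3` is odd,
squarefree, has one prime factor and divides `N(E_(1,2))` (`rad(1·2·3) = 6 ∣ 2N`, tree: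
`radical_natAbs_dvd_two_mul_conductorNorm_freyCurve`). [folklore] -/
theorem xiBound_hyps_witness :
    IsCoprime (1 : ℤ) 2 ∧ (1 : ℤ) * 2 * (1 + 2) ≠ 0 ∧ Odd 3 ∧ Squarefree 3 ∧
      Odd (3 : ℕ).primeFactors.card ∧ 3 ∣ (freyCurve 1 2).conductorNorm ℤ := by
  refine ⟨⟨-1, 1, by norm_num⟩, by norm_num, by decide, Irreducible.squarefree Nat.prime_three,
    by rw [Nat.prime_three.primeFactors]; simp, ?_⟩
  have h := radical_natAbs_dvd_two_mul_conductorNorm_freyCurve (a := 1) (b := 2) ⟨-1, 1, by norm_num⟩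
    (by norm_num)
  have h3 : (3 : ℕ) ∣ UniqueFactorizationMonoid.radical ((1 : ℤ) * 2 * (1 + 2)).natAbs :=
    (UniqueFactorizationMonoid.dvd_radical_iff_of_irreducible Nat.prime_three (by norm_num)).mpr
      (by norm_num)
  exact Nat.Coprime.dvd_of_dvd_mul_left (by norm_num) (h3.trans h)

/-- `15 ∣ N(E_(3,5))`: `rad(3·5·8) = 30 ∣ 2N`. [folklore] -/
theorem fifteen_dvd_conductorNorm_freyCurve_three_five :
    15 ∣ (freyCurve 3 5).conductorNorm ℤ := by
  have h := radical_natAbs_dvd_two_mul_conductorNorm_freyCurve (a := 3) (b := 5) ⟨2, -1, by norm_num⟩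
    (by norm_num)
  have h3 : (3 : ℕ) ∣ UniqueFactorizationMonoid.radical ((3 : ℤ) * 5 * (3 + 5)).natAbs :=
    (UniqueFactorizationMonoid.dvd_radical_iff_of_irreducible Nat.prime_three (by norm_num)).mpr
      (by norm_num)
  have h5 : (5 : ℕ) ∣ UniqueFactorizationMonoid.radical ((3 : ℤ) * 5 * (3 + 5)).natAbs :=
    (UniqueFactorizationMonoid.dvd_radical_iff_of_irreducible Nat.prime_five (by norm_num)).mpr
      (by norm_num)
  exact Nat.Coprime.mul_dvd_of_dvd_of_dvd (by norm_num)
    (Nat.Coprime.dvd_of_dvd_mul_left (by norm_num) (h3.trans h))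
    (Nat.Coprime.dvd_of_dvd_mul_left (by norm_num) (h5.trans h))

/-- **Refuted strengthening**: the two-sided bound `1 ≤ ξ ≤ C N^A` over ALL odd squarefree `N⁻ ∣ N`
(parity guard dropped) is false — at `(a, b) = (3, 5)`, `N⁻ = 15 ∣ N`, `ω(15) = 2` is even, there is no
definite quaternion algebra of discriminant `15`, and `brandtXi (N/15) 15 = 0 < 1`.  Moral for the
sibling items where `ξ` sits on the LOWER side (`DefiniteRTControlPrime`: `deg D ≤ C N^ε · ξ · v_q`): the
admissibility guard, and `Odd ω(N⁻)` in particular, cannot be dropped there. [folklore] -/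
theorem not_xiBound_twoSided_dropParity :
    ¬ ∃ A C : ℝ, ∀ a b : ℤ, IsCoprime a b → a * b * (a + b) ≠ 0 → ∀ (N : ℕ) [NeZero N],
      (freyCurve a b).conductorNorm ℤ = N → ∀ Nm : ℕ, Odd Nm → Squarefree Nm → Nm ∣ N →
      1 ≤ brandtXi (N / Nm) Nm (fun n => (freyCurve a b).LFunction n) ∧
        (brandtXi (N / Nm) Nm (fun n => (freyCurve a b).LFunction n) : ℝ) ≤ C * (N : ℝ) ^ A := by
  rintro ⟨A, C, h⟩
  haveI := isElliptic_freyCurve (a := 3) (b := 5) (by norm_num)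
  haveI : NeZero ((freyCurve 3 5).conductorNorm ℤ) :=
    ⟨(WeierstrassCurve.conductorNorm_pos_holds (freyCurve 3 5)).ne'⟩
  have hsq15 : Squarefree (15 : ℕ) := by
    rw [show (15 : ℕ) = 3 * 5 from rfl, Nat.squarefree_mul (by norm_num)]
    exact ⟨Irreducible.squarefree Nat.prime_three, Irreducible.squarefree Nat.prime_five⟩
  have h15 := (h 3 5 ⟨2, -1, by norm_num⟩ (by norm_num) _ rfl 15 (by decide) hsq15
    fifteen_dvd_conductorNorm_freyCurve_three_five).1
  have hcard : ¬ Odd (15 : ℕ).primeFactors.card := by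
    rw [show (15 : ℕ) = 3 * 5 from rfl, Nat.primeFactors_mul (by norm_num) (by norm_num),
      Nat.prime_three.primeFactors, Nat.prime_five.primeFactors]
    decide
  rw [brandtXi_of_isEmpty ⟨fun S => hcard S.odd_card_primeFactors⟩] at h15
  exact Nat.not_succ_le_zero 0 h15

end Summit.ABC.ABC.Theorems.XiBound.Negative
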